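import Literature.AlgebraicGeometry.HodgeTheory.MonodromyOrbitLatticeFiniteness
import Literature.AlgebraicGeometry.HodgeTheory.PolarizationFormMonodromyInvariant
import Literature.AlgebraicGeometry.HodgeTheory.HodgeGenericRealCarrier
import Literature.AlgebraicGeometry.HodgeTheory.HodgeTypeConjugation
import HarnessLib

/-!
# `bku_finite_monodromyOrbit_of_isHodgeGenericIn` from Hodge–Riemann positivity and type stability (assembly)

Family `hodge`, layer `Literature/AlgebraicGeometry/HodgeTheory`; proof file (theorems only, no
definition, no named fact) of the unit `bku_finite_monodromyOrbit_of_isHodgeGenericIn`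
(`HodgeGenericQbarDescent.lean`; Baldi–Klingler–Ullmo, Invent. Math. 235 (2024), §3.2: "the orbit
under monodromy of a Hodge class at a Hodge-generic point is finite", after Deligne and
Cattani–Deligne–Kaplan). The printed argument: the Hodge classes in the monodromy orbit of a rational
`(p,p)` class `α` at a Hodge-generic point are rational with bounded denominator, of type `(p,p)`, and
of constant norm for the (flat, rational) polarization `Q`, which is positive definite on `(p,p)`
classes — a bounded set in a lattice, hence finite.

`bku_finite_monodromyOrbit_of_isHodgeGenericIn_of_inputs` assembles the tree's PROVED pieces of that
argument on the real carriers `H²ᵖ(X_s(ℂ); ℂ)` —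

* `HodgeGenericRealCarrier`: Hodge-genericity for a classical geometric VHS datum is maximality of
  the Mumford–Tate rank of the Hodge structure of the fibre, read through any Hodge-symmetric Hodge
  model (`GeometricVHSData.mtRankAt_eq_mtRank_hodgeStructure`);
* `QbarFamilyLocalSystem`: the base change along `σ : ℚ̄ → ℂ` of a smooth quasi-projective family
  is cohomologically locally trivial over all of `S(ℂ)` and monodromy preserves rational and integral
  classes;
* `MonodromyOrbitLatticeFiniteness`: translates of bounded denominator, of a type `P` and of constant
  `Q`-norm are finite in number when `Q` is rational and positive on rational `P`-classes
  (`finite_setOf_isContinuationAlong_of_norm_eq_baseChangeHom`);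
* `PolarizationFormMonodromyInvariant`: the polarization form of the Lefschetz decomposition of the
  restriction of a GLOBAL class is monodromy invariant (`polarizationForm_transportFun_self`);
* `HodgeTypeConjugation`, `RationalHodgeClasses`: classes of type `(p,p)` form a `ℚ`-subspace —

and isolates the two remaining classical inputs as hypotheses in citable shape (see the theorem):
Hodge–Riemann for the family's polarization form (Voisin I Thm. 6.25, 6.32, §7.1.2) and the type
stability of monodromy translates at a Hodge-generic point (Deligne's theorem of the fixed part;
André 1992 §5; Cattani–Deligne–Kaplan 1995 §1).

## References

* [BaldiKlinglerUllmo2024] G. Baldi, B. Klingler, E. Ullmo, On the distribution of the Hodge locus,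
  Invent. Math. 235 (2024), §3.2.
* [CattaniDeligneKaplan1995JAMS] E. Cattani, P. Deligne, A. Kaplan, On the locus of Hodge classes,
  J. Amer. Math. Soc. 8 (1995), §1.
* [Andre1992] Y. André, Mumford–Tate groups of mixed Hodge structures and the theorem of the fixed
  part, Compositio Math. 82 (1992), §5.
* [DeligneHodgeII1971] P. Deligne, Théorie de Hodge II, Publ. Math. IHÉS 40 (1971), §4.2.
* [VoisinHodgeI2002] C. Voisin, Hodge Theory and Complex Algebraic Geometry I, CUP 2002, Thm. 6.25,
  Thm. 6.32, §7.1.2, §9.2.1.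
-/

noncomputable section

open CategoryTheory AlgebraicGeometry
open _root_.Topology
open Literature.AlgebraicTopology.SingularHomology Literature.Geometry.Kaehler
open Literature.AlgebraicGeometry.Motives

namespace Literature.AlgebraicGeometry.HodgeTheory

section HodgeTheory

/-- **The named fact `bku_finite_monodromyOrbit_of_isHodgeGenericIn` from its two classical
inputs, on the tree's real carriers** (everything else PROVED in the tree). The inputs, in citable
shape:

* `hHR` — **Hodge–Riemann for the family** (Voisin I Thm. 6.25, Thm. 6.32, §7.1.2): at each complex
  point `s` of the base of a smooth projective `ℚ̄`-family, some global class `K ∈ H²(𝒳(ℂ); ℂ)` (the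
  relative hyperplane class) restricts to a class `κ_s` with the hard Lefschetz property on the fibre
  `X_s`, and for some trace `τ` on `H²ⁿ(X_s(ℂ); ℂ)` the polarization form
  `Q = polarizationForm κ_s n … τ (2p)` of the Lefschetz decomposition (Voisin I §7.1.2) is RATIONAL on
  rational classes and POSITIVE on non-zero rational `(p,p)` classes;
* `hType` — **type stability at a Hodge-generic point** (Deligne, Hodge II 4.2 / "théorème de la
  partie fixe"; André 1992 §5; Cattani–Deligne–Kaplan 1995 §1; Baldi–Klingler–Ullmo §3.2): at a
  point `s` where the Mumford–Tate rank of the Hodge structure of `H²ᵖ(X_t(ℂ); ℚ)` (read through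
  Hodge-symmetric Hodge models of the fibres) is maximal, every monodromy translate `γ_* α` of a
  rational `(p,p)` class `α` is again of type `(p,p)`.

Proof: Hodge-genericity for the datum `D` is maximality of that Mumford–Tate rank
(`GeometricVHSData.isHodgeGenericIn_iff_hodgeStructure`, `HodgeGenericRealCarrier`); the translates of
`α` are rational with a common denominator and of type `(p,p)` (`hType`); `Q` is monodromy
invariant (`polarizationForm_transportFun_self`, `PolarizationFormMonodromyInvariant`), so they all
have norm `Q(α, α)`; and such classes are finite in number (`finite_setOf_isContinuationAlong_of_norm_eq_baseChangeHom`,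
`MonodromyOrbitLatticeFiniteness`: `H²ᵖ(X_s(ℂ); ℚ)` finite dimensional, `H²ᵖ(X_s(ℂ); ℤ)` finitely
generated, Sylvester over `ℚ`). [cite: BaldiKlinglerUllmo2024, §3.2]
[cite: CattaniDeligneKaplan1995JAMS, §1] [cite: VoisinHodgeI2002, Thm. 6.32 and §7.1.2] -/
theorem bku_finite_monodromyOrbit_of_isHodgeGenericIn_of_inputs
    (hHR : ∀ (σ : AlgebraicClosure ℚ →+* ℂ) ⦃𝒳₀ S₀ : SchemeOver (AlgebraicClosure ℚ)⦄ (f₀ : 𝒳₀ ⟶ S₀)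
      (n p : ℕ) (hf : IsSmoothProjectiveFamily ((baseChangeHom σ).map f₀) n),
      IsQuasiProjectiveOver 𝒳₀ → IsQuasiProjectiveOver S₀ → IrreducibleSpace S₀.left →
      AlgebraicGeometry.Smooth S₀.hom →
      ∀ s : ComplexPoints ((baseChangeHom σ).obj S₀),
      ∃ (K : complexBetti ((baseChangeHom σ).obj 𝒳₀) 2)
        (hL : HasHardLefschetzProperty
          (complexBetti.map (fiberι ((baseChangeHom σ).map f₀) s) 2 K) n)
        (τ : complexBetti (fiberOver ((baseChangeHom σ).map f₀) s) (2 * n) →ₗ[ℂ] ℂ),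
        (∀ x y : complexBetti (fiberOver ((baseChangeHom σ).map f₀) s) (2 * p),
            IsRationalClass x → IsRationalClass y → ∃ q : ℚ,
              polarizationForm (complexBetti.map (fiberι ((baseChangeHom σ).map f₀) s) 2 K) n hL
                (fun _ hm ↦ ComplexPoints.subsingleton_singularCohomology_of_lt
                  (hf.isSmoothProjective s) ℂ hm) τ (2 * p) x y = q) ∧
        (∀ x : complexBetti (fiberOver ((baseChangeHom σ).map f₀) s) (2 * p),
            IsRationalClass x → IsOfHodgeType n (fiberOver ((baseChangeHom σ).map f₀) s) (2 * p) p p x →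
              x ≠ 0 → ∃ r : ℚ, 0 < r ∧
                polarizationForm (complexBetti.map (fiberι ((baseChangeHom σ).map f₀) s) 2 K) n hL
                  (fun _ hm ↦ ComplexPoints.subsingleton_singularCohomology_of_lt
                    (hf.isSmoothProjective s) ℂ hm) τ (2 * p) x x = r))
    (hType : ∀ [HodgeTensorFacts.{0, 0}] (σ : AlgebraicClosure ℚ →+* ℂ)
      ⦃𝒳₀ S₀ : SchemeOver (AlgebraicClosure ℚ)⦄ (f₀ : 𝒳₀ ⟶ S₀) (n p : ℕ)
      (hf : IsSmoothProjectiveFamily ((baseChangeHom σ).map f₀) n)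
      (_ : IsQuasiProjectiveOver 𝒳₀) (hS₀ : IsQuasiProjectiveOver S₀) [IrreducibleSpace S₀.left]
      [AlgebraicGeometry.Smooth S₀.hom]
      (A : ∀ t : ComplexPoints ((baseChangeHom σ).obj S₀),
          HodgeModel n (fiberOver ((baseChangeHom σ).map f₀) t))
      (hA : ∀ t, (A t).IsHodgeSymmetric)
      [∀ t, Module.Finite ℚ
        (singularCohomology ℚ ℚ (ComplexPoints (fiberOver ((baseChangeHom σ).map f₀) t)) (2 * p))]
      (s : ComplexPoints ((baseChangeHom σ).obj S₀)),
      (∀ t, ((A t).hodgeStructure (hf.isSmoothProjective t) (hA t) (2 * p)).mtRank ≤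
          ((A s).hodgeStructure (hf.isSmoothProjective s) (hA s) (2 * p)).mtRank) →
      ∀ (α : complexBetti (fiberOver ((baseChangeHom σ).map f₀) s) (2 * p)),
        IsRationalClass α → IsOfHodgeType n (fiberOver ((baseChangeHom σ).map f₀) s) (2 * p) p p α →
        ∀ γ : Path.Homotopic.Quotient
            (⟨s, Set.mem_univ s⟩ : (Set.univ : Set (ComplexPoints ((baseChangeHom σ).obj S₀))))
            ⟨s, Set.mem_univ s⟩,
          IsOfHodgeType n (fiberOver ((baseChangeHom σ).map f₀) s) (2 * p) p p
            (transportFun ((baseChangeHom σ).map f₀) (2 * p)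
              (isCohomologicallyLocallyTrivialOn_univ_baseChangeHom σ f₀ hf hS₀) γ α :)) :
    bku_finite_monodromyOrbit_of_isHodgeGenericIn := by
  intro B hB _ σ 𝒳₀ S₀ f₀ n p D _ h𝒳₀ hS₀ hirr hsm s hs α hαr hαh
  haveI := hirr
  haveI := hsm
  have hf := D.isSmoothProjectiveFamily
  have hXs : IsSmoothProjective n (fiberOver ((baseChangeHom σ).map f₀) s) := hf.isSmoothProjective s
  -- Hodge-symmetric models of the fibres; Hodge-genericity of `s` on real carriers
  choose A hA using fun t : ComplexPoints ((baseChangeHom σ).obj S₀) ↦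
    exists_isReal_hodgeModel_holds.exists_isHodgeSymmetric (hf.isSmoothProjective t)
  haveI : ∀ t : ComplexPoints ((baseChangeHom σ).obj S₀), Module.Finite ℚ
      (singularCohomology ℚ ℚ (ComplexPoints (fiberOver ((baseChangeHom σ).map f₀) t)) (2 * p)) :=
    fun t ↦ finite_singularCohomology_rat_complexPoints (hf.isSmoothProjective t) (2 * p)
  have hgen : ∀ t, ((A t).hodgeStructure (hf.isSmoothProjective t) (hA t) (2 * p)).mtRank ≤
      ((A s).hodgeStructure (hf.isSmoothProjective s) (hA s) (2 * p)).mtRank := by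
    intro t
    have ht := hs.2 t (Set.mem_univ t)
    rwa [D.mtRankAt_eq_mtRank_hodgeStructure hB (A t) (hA t),
      D.mtRankAt_eq_mtRank_hodgeStructure hB (A s) (hA s)] at ht
  -- the Hodge–Riemann input at `s`
  obtain ⟨K, hL, τ, hQrat, hQpos⟩ := hHR σ f₀ n p hf h𝒳₀ hS₀ hirr hsm s
  -- the lattice theorem, with `P` = "of type `(p,p)`" and `Q` the polarization form of `κ_s`
  refine finite_setOf_isContinuationAlong_of_norm_eq_baseChangeHom (2 * p) σ f₀ hf hS₀ s
    (fun x ↦ IsOfHodgeType n (fiberOver ((baseChangeHom σ).map f₀) s) (2 * p) p p x)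
    (IsOfHodgeType.zero (A s) (2 * p) p p) (fun x y hx hy ↦ hx.add hXs hy)
    (fun c x hx ↦ hx.smul (c : ℂ)) _ hQrat hQpos α hαr (fun γ ↦ ?_) (fun γ ↦ ?_)
  · exact hType σ f₀ n p hf h𝒳₀ hS₀ A hA s hgen α hαr hαh γ
  · exact polarizationForm_transportFun_self ((baseChangeHom σ).map f₀)
      (isCohomologicallyLocallyTrivialOn_univ_baseChangeHom σ f₀ hf hS₀) K (s := ⟨s, Set.mem_univ s⟩)
      hXs hL τ γ α

end HodgeTheory

end Literature.AlgebraicGeometry.HodgeTheory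

end
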